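import Literature.AlgebraicGeometry.HodgeTheory.WeilClassesCyclicPrymDimension
import Literature.AlgebraicTopology.SingularHomology.FreeActionLefschetzNumber
import HarnessLib

/-!
# Schoen's primitive Prym: the Lefschetz-number input PROVED (Smith theory), and Schoen's fact from `H¹(J) ≅ H¹(C)` and Schoen's cycle

Family `hodge`, layer `Literature/AlgebraicGeometry/HodgeTheory`; fourth file of the story
`WeilClassesCyclicPrym` → `WeilClassesCyclicPrymTyping` → `WeilClassesCyclicPrymDimension` → this file.
The previous file reduced the named fact `Schoen1988_cyclicPrym_weilClasses_algebraic_degreeSix`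
(Schoen 1988, Cor. 3.1 with Thm. 2.0; Patel–Zhang 2025, Thm 5.3) to three inputs: (i) the named fact
`Motives.isIso_bettiCohomology_map_abelJacobi`, (ii) the vanishing of the Lefschetz numbers of the
fixed-point-free maps `α, …, α⁵` on the closed surface `C(ℂ)` (the hypothesis `hL`, there supplied by the
Lefschetz fixed point theorem `hLFT`, absent from the tree), and (iii) Schoen's cycle.

This file ELIMINATES input (ii): the Chevalley–Weil count `dim B = 8` only uses the sums of the
Lefschetz numbers over the three cyclic subgroups `⟨α³⟩, ⟨α²⟩, ⟨α⟩` of `ℤ/6`, and these sums vanish by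
Smith theory and the transfer (E. E. Floyd 1952 / G. E. Bredon, *Introduction to Compact Transformation
Groups* (1972), Ch. III Thm. 7.10: `χ(X) = p·χ(X/G)` for a free `ℤ/p`-action, `𝔽ₚ`-coefficients;
A. Hatcher, *Algebraic Topology* (2002), Prop. 3G.1: `H^k(X/G; ℂ) = H^k(X; ℂ)^G`), PROVED for closed
topological manifolds in `AlgebraicTopology/SingularHomology/FreeActionLefschetzNumber.lean`
(`lefschetz_sums_of_free_zmod_six`).  Patel–Zhang's own route to the count is exactly this Euler
characteristic argument (Lemma 2.9, p. 6: *"`χ_top(C', L_χ) = χ_top(C') = 2 - 2g`"*).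

* `complexPointsHomeomorph` — the homeomorphism of `C(ℂ)` induced by an automorphism `α` with `α⁶ = 𝟙`;
* `lefschetz_sums_of_pow_six` — **`L(α³) = 0`, `L(α²) + L(α⁴) = 0`, `L(α) + L(α⁵) = 0`** for the
  Lefschetz numbers `L(β) = tr(β^*|H⁰) - tr(β^*|H¹) + tr(β^*|H²)` on `C(ℂ)`, unconditionally;
* `finrank_ker_cyclotomic₆_eq_sixteen_of_sums` — the character count of the previous file with the
  summed trace hypotheses;
* **`dim_kerComponent_cyclotomic₆_pushforward_eq_eight_of_isIso`** — `dim B = 8` from (i) ALONE;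
* **`Schoen1988_cyclicPrym_weilClasses_algebraic_degreeSix_of_isIso_of_exists`** — Schoen's fact from
  (i) and (iii) (Schoen's cycle: one non-zero algebraic class in `E₊(B, ψ₀)`), the Lefschetz fixed point
  theorem being no longer needed.

Everything here is PROVED; no named fact, no definition of class type, no instance is introduced.

## References

* [Schoen1988HodgeWeil] C. Schoen, Hodge classes on self-products of a variety with an automorphism,
  Compositio Math. 65 (1988), Lemma 1.5, Thm. 2.0 (p. 11), Cor. 3.1 (p. 24).
* [PatelZhang2025PrymHodge] D. Patel, Z. Zhang, arXiv:2506.13729 (2025), Lemma 2.9 (p. 6), Lemma 5.1,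
  Thm 5.3 (p. 12).
* [Bredon1972] G. E. Bredon, Introduction to Compact Transformation Groups
  (1972), Ch. III Thm. 7.10.
* [HatcherAT2002] A. Hatcher, Algebraic Topology (2002), §3.G Prop. 3G.1.
* [Lange2023AbelianVarietiesC] H. Lange, Abelian Varieties over the Complex Numbers (2023), §4.1.1.
-/

noncomputable section

namespace Literature.AlgebraicGeometry.HodgeTheory

open CategoryTheory AlgebraicGeometry
open Literature.AlgebraicTopology.SingularHomology Literature.AlgebraicGeometry.Motives

universe u

/-! ### §1 The character count with summed traces -/

section LinearAlgebra

variable {V : Type*} [AddCommGroup V] [Module ℂ V]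

/-- **`dim ker Φ₆(T) = 16`** from `T⁶ = 1`, `dim V = 50` and the traces `tr Tʲ = 1 + lʲ - Lⱼ` (`l² = 1`)
whose "Lefschetz corrections" vanish in the mean over each cyclic subgroup of `ℤ/6`:
`L₃ = 0`, `L₂ + L₄ = 0`, `L₁ + L₅ = 0` — the count `6·dim ker Φ₆(T) = 2 dim V + tr T - tr T² - 2tr T³ - tr T⁴ + tr T⁵`
(`six_mul_finrank_ker_cyclotomic₆`) only involves `tr T + tr T⁵`, `tr T² + tr T⁴` and `tr T³`.
[cite: PatelZhang2025PrymHodge, Lemma 2.9 and Lemma 5.1] -/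
theorem finrank_ker_cyclotomic₆_eq_sixteen_of_sums [FiniteDimensional ℂ V] (T : Module.End ℂ V)
    (hT : T ^ 6 = 1) (hV : Module.finrank ℂ V = 50) {l : ℂ} (hl : l ^ 2 = 1) (L : ℕ → ℂ)
    (hL3 : L 3 = 0) (hL24 : L 2 + L 4 = 0) (hL15 : L 1 + L 5 = 0)
    (htr : ∀ j : ℕ, 1 ≤ j → j ≤ 5 → LinearMap.trace ℂ V (T ^ j) = 1 + l ^ j - L j) :
    Module.finrank ℂ (LinearMap.ker (1 - T + T ^ 2)) = 16 := by
  have h := six_mul_finrank_ker_cyclotomic₆ T hT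
  have t1 : LinearMap.trace ℂ V T = 1 + l - L 1 := by simpa using htr 1 le_rfl (by norm_num)
  have hl3 : l ^ 3 = l := by rw [pow_succ, hl, one_mul]
  have hl4 : l ^ 4 = 1 := by rw [show (4 : ℕ) = 2 * 2 from rfl, pow_mul, hl, one_pow]
  have hl5 : l ^ 5 = l := by rw [pow_succ, hl4, one_mul]
  rw [hV, t1, htr 2 (by norm_num) (by norm_num), htr 3 (by norm_num) (by norm_num),
    htr 4 (by norm_num) (by norm_num), htr 5 (by norm_num) (by norm_num), hl, hl3, hl4, hl5] at h
  have h' : (6 : ℂ) * Module.finrank ℂ (LinearMap.ker (1 - T + T ^ 2)) = 6 * 16 := by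
    rw [h]; push_cast; linear_combination (2 : ℂ) * hL3 + hL24 - hL15
  exact_mod_cast mul_left_cancel₀ (by norm_num : (6 : ℂ) ≠ 0) h'

end LinearAlgebra

/-! ### §2 The Lefschetz numbers of `α, …, α⁵` on the closed surface `C(ℂ)` -/

section Surface

variable {C : Motives.SchemeOver ℂ}

/-- **The homeomorphism of `C(ℂ)` induced by an automorphism `α` with `α⁶ = 𝟙`** (inverse `α⁵`).
[folklore] -/
def complexPointsHomeomorph (α : C ⟶ C) (hα : α ≫ α ≫ α ≫ α ≫ α ≫ α = 𝟙 C) :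
    Motives.ComplexPoints C ≃ₜ Motives.ComplexPoints C where
  toFun := Motives.AlgPoints.mapContinuous (L := ℂ) α
  invFun := Motives.AlgPoints.mapContinuous (L := ℂ) (α ≫ α ≫ α ≫ α ≫ α)
  left_inv x := by
    change Motives.AlgPoints.map (α ≫ α ≫ α ≫ α ≫ α) (Motives.AlgPoints.map α x) = x
    rw [← Motives.AlgPoints.map_comp_apply, hα, Motives.AlgPoints.map_id_apply]
  right_inv x := by
    change Motives.AlgPoints.map α (Motives.AlgPoints.map (α ≫ α ≫ α ≫ α ≫ α) x) = x
    rw [← Motives.AlgPoints.map_comp_apply]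
    simp only [Category.assoc]
    rw [hα, Motives.AlgPoints.map_id_apply]
  continuous_toFun := (Motives.AlgPoints.mapContinuous (L := ℂ) α).continuous
  continuous_invFun := (Motives.AlgPoints.mapContinuous (L := ℂ) (α ≫ α ≫ α ≫ α ≫ α)).continuous

/-- The underlying continuous map of `complexPointsHomeomorph α` is `α(ℂ)`. [folklore] -/
lemma coe_complexPointsHomeomorph (α : C ⟶ C) (hα : α ≫ α ≫ α ≫ α ≫ α ≫ α = 𝟙 C) :
    ((complexPointsHomeomorph α hα : Motives.ComplexPoints C ≃ₜ Motives.ComplexPoints C) :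
      C(Motives.ComplexPoints C, Motives.ComplexPoints C)) = Motives.AlgPoints.mapContinuous (L := ℂ) α :=
  rfl

/-- Powers of `complexPointsHomeomorph α` act by iterating `α`: `a² x = x ≫ α ≫ α`, `a³ x = x ≫ α ≫ α ≫ α`.
[folklore] -/
lemma complexPointsHomeomorph_pow_apply (α : C ⟶ C) (hα : α ≫ α ≫ α ≫ α ≫ α ≫ α = 𝟙 C)
    (m : ℕ) (x : Motives.ComplexPoints C) (β : C ⟶ C)
    (hβ : ∀ y : Motives.ComplexPoints C, Motives.AlgPoints.map β y = ((complexPointsHomeomorph α hα) ^ m) y) :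
    ((complexPointsHomeomorph α hα) ^ (m + 1)) x = Motives.AlgPoints.map (α ≫ β) x := by
  rw [pow_succ, Homeomorph.mul_apply, Motives.AlgPoints.map_comp_apply, hβ]
  rfl

/-- **The Lefschetz numbers of `α, …, α⁵` vanish in the mean over the cyclic subgroups of `ℤ/6`**:
for a smooth projective complex curve `C` and an automorphism `α` with `α⁶ = 𝟙` whose powers `α²`, `α³`
have no fixed complex point, the Lefschetz numbers `L(j) = tr((α^*)ʲ|H⁰) - tr((α^*)ʲ|H¹) + tr((α^*)ʲ|H²)`
on `C(ℂ)` satisfy `L(3) = 0`, `L(2) + L(4) = 0`, `L(1) + L(5) = 0` — by Smith theory and the transfer on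
the closed surface `C(ℂ)` (`lefschetz_sums_of_free_zmod_six`), NOT by the Lefschetz fixed point theorem.
(Patel–Zhang Lemma 2.9: the Euler characteristic count on the quotient curve.)
[cite: PatelZhang2025PrymHodge, Lemma 2.9] [cite: Bredon1972, Ch. III Thm. 7.10]
[cite: HatcherAT2002, §3.G Prop. 3G.1] -/
theorem lefschetz_sums_of_pow_six (hC : Motives.IsSmoothProjective 1 C) (α : C ⟶ C)
    (hα : α ≫ α ≫ α ≫ α ≫ α ≫ α = 𝟙 C)
    (hfree : ∀ P : Motives.ComplexPoints C, P ≫ (α ≫ α) ≠ P ∧ P ≫ (α ≫ α ≫ α) ≠ P) :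
    let L : ℕ → ℂ := fun j =>
      LinearMap.trace ℂ _ ((complexBetti.map α 0).hom ^ j) -
        LinearMap.trace ℂ _ ((complexBetti.map α 1).hom ^ j) +
        LinearMap.trace ℂ _ ((complexBetti.map α 2).hom ^ j)
    L 3 = 0 ∧ L 2 + L 4 = 0 ∧ L 1 + L 5 = 0 := by
  intro L
  letI := hC.chartedSpace
  haveI := Motives.ComplexPoints.compactSpace_of_isSmoothProjective hC
  haveI := Motives.ComplexPoints.t2Space_of_isSmoothProjective hC
  haveI : Nonempty (Motives.ComplexPoints C) := Motives.nonempty_algPoints_of_isSmoothProjective hC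
  set a := complexPointsHomeomorph α hα with ha_def
  have ha1 : ∀ x, a x = Motives.AlgPoints.map α x := fun x => rfl
  have ha2 : ∀ x, (a ^ 2) x = Motives.AlgPoints.map (α ≫ α) x := fun x =>
    complexPointsHomeomorph_pow_apply α hα 1 x α fun y => by rw [pow_one]; rfl
  have ha3 : ∀ x, (a ^ 3) x = Motives.AlgPoints.map (α ≫ α ≫ α) x := fun x =>
    complexPointsHomeomorph_pow_apply α hα 2 x (α ≫ α) ha2
  have ha4 : ∀ x, (a ^ 4) x = Motives.AlgPoints.map (α ≫ α ≫ α ≫ α) x := fun x =>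
    complexPointsHomeomorph_pow_apply α hα 3 x (α ≫ α ≫ α) ha3
  have ha5 : ∀ x, (a ^ 5) x = Motives.AlgPoints.map (α ≫ α ≫ α ≫ α ≫ α) x := fun x =>
    complexPointsHomeomorph_pow_apply α hα 4 x (α ≫ α ≫ α ≫ α) ha4
  have ha6 : a ^ 6 = 1 := by
    refine Homeomorph.ext fun x => ?_
    rw [complexPointsHomeomorph_pow_apply α hα 5 x (α ≫ α ≫ α ≫ α ≫ α) ha5, hα,
      Motives.AlgPoints.map_id_apply, Homeomorph.one_apply]
  have h2 : ∀ x, (a ^ 2) x ≠ x := fun x hx => (hfree x).1 (by rw [ha2] at hx; exact hx)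
  have h3 : ∀ x, (a ^ 3) x ≠ x := fun x hx => (hfree x).2 (by rw [ha3] at hx; exact hx)
  have h := lefschetz_sums_of_free_zmod_six (n := 2 * 1) a ha6 h2 h3
  -- unfold the three-term sums
  have hsum : ∀ j : ℕ, (∑ k ∈ Finset.range (2 * 1 + 1), (-1 : ℂ) ^ k *
      LinearMap.trace ℂ _ ((singularCohomology.map ℂ ℂ
        (a : C(Motives.ComplexPoints C, Motives.ComplexPoints C)) k).hom ^ j)) = L j := by
    intro j
    rw [show 2 * 1 + 1 = 3 from rfl, Finset.sum_range_succ, Finset.sum_range_succ, Finset.sum_range_one]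
    change (-1 : ℂ) ^ 0 * LinearMap.trace ℂ _ ((complexBetti.map α 0).hom ^ j) +
      (-1 : ℂ) ^ 1 * LinearMap.trace ℂ _ ((complexBetti.map α 1).hom ^ j) +
      (-1 : ℂ) ^ 2 * LinearMap.trace ℂ _ ((complexBetti.map α 2).hom ^ j) = L j
    simp only [L]
    ring
  simp only [hsum] at h
  exact h

end Surface

/-! ### §3 `dim B = 8` from `H¹(J) ≅ H¹(C)` alone, and Schoen's fact from (i) and Schoen's cycle -/

section Assembly

variable {C : Motives.SchemeOver ℂ} (𝒥 : Jacobian C)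

/-- **`dim B = 8` for Schoen's primitive Prym `B = (Ker (𝟙 - α_* + α_*²))⁰`** of an étale `ℤ/6`-cover of
a genus-`5` curve (`g(C) = 25`), from the named fact `H¹(J(C)) ≅ H¹(C)`
(`Motives.isIso_bettiCohomology_map_abelJacobi`) ALONE: the Chevalley–Weil count
(Patel–Zhang Lemma 2.9 / 5.1: every primitive character occurs `h = 8` times in `H¹`) through
`six_mul_finrank_ker_cyclotomic₆`, with the Lefschetz sums of `lefschetz_sums_of_pow_six` (Smith theory +
transfer on `C(ℂ)`) in place of the Lefschetz fixed point theorem.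
[cite: PatelZhang2025PrymHodge, Lemma 2.9 and Lemma 5.1] [cite: Schoen1988HodgeWeil, Lemma 1.5]
[cite: Lange2023AbelianVarietiesC, §4.1.1 and Lemma 4.4.1] -/
theorem dim_kerComponent_cyclotomic₆_pushforward_eq_eight_of_isIso
    (hI : Motives.isIso_bettiCohomology_map_abelJacobi) (α : C ⟶ C)
    (hC : Motives.IsSmoothProjective 1 C) (h25 : 𝒥.J.dim = 25) (hα : α ≫ α ≫ α ≫ α ≫ α ≫ α = 𝟙 C)
    (hfree : ∀ P : Motives.ComplexPoints C, P ≫ (α ≫ α) ≠ P ∧ P ≫ (α ≫ α ≫ α) ≠ P)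
    {s : 𝒥.J ⟶ 𝒥.J} (hs : s = 𝒥.pushforward 𝒥 α) :
    (Motives.AbelianVariety.kerComponent (𝟙 𝒥.J - s + s ≫ s)).dim = 8 := by
  haveI := finite_complexBetti_abelianVariety 𝒥.J 1
  set S := (complexBetti.map s.hom.hom.hom 1).hom with hSdef
  -- `2 dim B = dim ker (1 - S + S²)`
  have hD := two_mul_dim_kerComponent_eq_finrank_ker (𝟙 𝒥.J - s + s ≫ s)
  rw [complexBetti_map_cyclotomic₆_one_hom, ← hSdef] at hD
  -- `S⁶ = 1`, `dim H¹(J) = 50`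
  have hS6 : S ^ 6 = 1 := complexBetti_map_one_hom_pow_six (pushforward_comp_pow_six_of_pow_six 𝒥 hα hs)
  have h50 : Module.finrank ℂ (complexBetti 𝒥.J.X 1) = 50 := by
    rw [Motives.AbelianVariety.finrank_complexBetti_one, h25]
  -- the traces: `tr Sʲ = tr((α^*)ʲ|H¹(C)) = tr(H⁰) + tr(H²) - L j = 1 + lʲ - L j`
  set l := LinearMap.trace ℂ _ (complexBetti.map α 2).hom with hl
  have hl2 : l ^ 2 = 1 := sq_trace_complexBetti_map_two_eq_one hC α hα
  obtain ⟨hL3, hL24, hL15⟩ := lefschetz_sums_of_pow_six hC α hα hfree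
  set L : ℕ → ℂ := fun j =>
    LinearMap.trace ℂ _ ((complexBetti.map α 0).hom ^ j) -
      LinearMap.trace ℂ _ ((complexBetti.map α 1).hom ^ j) +
      LinearMap.trace ℂ _ ((complexBetti.map α 2).hom ^ j) with hLdef
  have htr : ∀ j : ℕ, 1 ≤ j → j ≤ 5 → LinearMap.trace ℂ _ (S ^ j) = 1 + l ^ j - L j := by
    intro j _ _
    rw [hSdef, hs, trace_pow_complexBetti_map_pushforward_eq 𝒥 hI hC α j]
    simp only [hLdef]
    rw [trace_pow_complexBetti_map_zero hC α j, trace_pow_complexBetti_map_two_of_curve hC α j]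
    ring
  have h16 := finrank_ker_cyclotomic₆_eq_sixteen_of_sums S hS6 h50 hl2 L hL3 hL24 hL15 htr
  omega

/-- **Schoen's fact from `H¹(J) ≅ H¹(C)` and Schoen's cycle.** The named fact
`Schoen1988_cyclicPrym_weilClasses_algebraic_degreeSix` (Schoen 1988, Cor. 3.1 with Thm. 2.0;
Patel–Zhang 2025, Thm 5.3) follows from (i) the named fact `Motives.isIso_bettiCohomology_map_abelJacobi`
(`H¹(J(C)) ≅ H¹(C)`, Lange §4.1.1) and (iii) Schoen's cycle — ONE non-zero algebraic class in the Weil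
line `E₊` of `(B, ψ₀)` (Schoen Thm. 2.0 / Cor. 3.1; Patel–Zhang Prop. 3.2–Thm. 4.4: symmetric powers of
the quotient curve, the Abel–Jacobi projective bundle and the class-field-theory square; NOT in the
tree): (i) gives `dim B = 8` (`dim_kerComponent_cyclotomic₆_pushforward_eq_eight_of_isIso`, the
Lefschetz input now proved), and the typing brick
`Schoen1988_cyclicPrym_weilClasses_algebraic_degreeSix_of_dim_eq_eight_of_exists` concludes.
[cite: Schoen1988HodgeWeil, Cor. 3.1 (p. 24) with Thm. 2.0 (p. 11)]
[cite: PatelZhang2025PrymHodge, Lemma 2.9, Lemma 5.1, Thm 4.4, Thm 5.3] -/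
theorem Schoen1988_cyclicPrym_weilClasses_algebraic_degreeSix_of_isIso_of_exists
    (hI : Motives.isIso_bettiCohomology_map_abelJacobi)
    (hZ : ∀ (C : Motives.SchemeOver ℂ) (𝒥 : Jacobian C) (α : C ⟶ C),
      Motives.IsSmoothProjective 1 C → 𝒥.J.dim = 25 →
      α ≫ α ≫ α ≫ α ≫ α ≫ α = 𝟙 C →
      (∀ P : Motives.ComplexPoints C, P ≫ (α ≫ α) ≠ P ∧ P ≫ (α ≫ α ≫ α) ≠ P) →
    ∀ (s : 𝒥.J ⟶ 𝒥.J), s = 𝒥.pushforward 𝒥 α →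
    ∀ (sB ψ₀ : Motives.AbelianVariety.kerComponent (𝟙 𝒥.J - s + s ≫ s) ⟶
        Motives.AbelianVariety.kerComponent (𝟙 𝒥.J - s + s ≫ s)),
      sB ≫ Motives.AbelianVariety.kerComponentι (𝟙 𝒥.J - s + s ≫ s) =
        Motives.AbelianVariety.kerComponentι (𝟙 𝒥.J - s + s ≫ s) ≫ s →
      ψ₀ = 𝟙 _ + 2 • (sB ≫ sB) →
      ∃ c ∈ weilClassesPlus (Motives.AbelianVariety.kerComponent (𝟙 𝒥.J - s + s ≫ s)) ψ₀ 4 3,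
        c ∈ algebraicClasses (Motives.AbelianVariety.kerComponent (𝟙 𝒥.J - s + s ≫ s)).X 4 ∧ c ≠ 0) :
    Schoen1988_cyclicPrym_weilClasses_algebraic_degreeSix :=
  Schoen1988_cyclicPrym_weilClasses_algebraic_degreeSix_of_dim_eq_eight_of_exists
    fun C 𝒥 α hC h25 hα hfree s hs sB ψ₀ hsB hψ₀ =>
      ⟨dim_kerComponent_cyclotomic₆_pushforward_eq_eight_of_isIso 𝒥 hI α hC h25 hα hfree hs,
        hZ C 𝒥 α hC h25 hα hfree s hs sB ψ₀ hsB hψ₀⟩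

end Assembly

end Literature.AlgebraicGeometry.HodgeTheory

end
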